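import Literature.Barriers.CriticalPhenomena.RigorousRGSmallParameterFRDSelfSimilarity
import HarnessLib

/-!
# `RigorousRGSmallParameter` (Slade, Theorem 1.4.1): the self-similarity (10.38) with an
# `s`-independent scaling function, and the decay (10.39) of `w̄`

Third file of the §10.3 layer, after `RigorousRGSmallParameterFRDContinuumApproximation.lean`
(Bauerschmidt's Proposition 3.1) and `RigorousRGSmallParameterFRDSelfSimilarity.lean` ((10.38)
against the continuum kernel `w_c` built with the lattice normalisation `M² = 2d+s`). G. Slade,
*Critical exponents for long-range `O(n)` models below the upper critical dimension*, Commun. Math.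
Phys. **358** (2018), §10.3: "(10.38) `w(t,x;s) = (c/t)^{d-2}w̄(cx/t;st²) + O(t^{-(d-1)}(1+st²)^{-p})`,
with the error estimate valid for any `p ≥ 0` and uniform in bounded `s`, and in particular for
`s ≤ 1` … For any `p ≥ 0`, the function `w̄` obeys (by [Baue13a]) (10.39) `w̄(cx/t;st²) ≤
O(1+st²)^{-p}`." In (10.38) the constant `c` is fixed, whereas the normalisation `M² = 2d+s` of the
explicit lattice decomposition (`RigorousRGSmallParameterFRDDecomposition.lean`, after
Bauerschmidt–Brydges–Slade) depends on the Kato variable `s`; this file removes that dependence for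
`s ≤ 1` — the continuum symbol `(t²/(cM²))f(t√((|k|₂²+s)/M²))` is within
`O((1+t²s/M²)^{-p}(1+‖ak‖²)^{-q})` of `(t²/(2dc))f(t√((|k|₂²+s)/(2d)))` ("Similarly, we may proceed for
the other differences" in [Baue13a, §3.2.2]: a difference of normalisations `t²s/(2dcM²)` and a mean
value step) — so that the scaling function of the self-similar form is the same for all scales, as
Lemma 10.3.1 and Lemma 5.2.2 require (`c_k(x) = L^{-(d-α)k}c_0(L^{-k}x)` with one `c_0`).

## What this file proves (everything; two definitions, no named fact)

* `FRD.wHatCont0`, `FRD.wKerCont0` — the continuum symbol / kernel with `M₀² = 2d`;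
  `FRD.continuous_wHatCont0`, `FRD.one_add_norm_smul_sq_le_of_le`.
* `FRD.abs_wHatCont_sub_wHatCont0_le` (pointwise), **`FRD.abs_wKerCont_sub_wKerCont0_le`**
  (`|w_c - w₀| ≤ Ct^{-d}(1+t²s/(2d+s))^{-p}`, `s ∈ (0,1]`, `t > 0`).
* **`FRD.wKerCont0_eq_scaling`** — `w₀(t,x;s) = (M₀/t)^d(t²/(2dc))w̄(M₀x/t; st²/(2d))`, `M₀ = √(2d)`.
* **`FRD.abs_wKer_sub_wKerCont0_le`** — **(10.38), PROVED** with the `s`-independent scaling function: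
  `|w(t,x;s) - w₀(t,x;s)| ≤ C(t²/t^d)t⁻¹(1+t²s/(2d+s))^{-p}` for `s ∈ (0,1]`, `t ≥ 1`, `x ∈ ℤ^d`.
* **`FRD.abs_wbar_le`** — **(10.39), PROVED**: `|w̄(y;σ)| ≤ C(1+σ)^{-p}` for `σ ≥ 0`.
-/

noncomputable section

namespace Literature.Barriers.CriticalPhenomena

open _root_.MeasureTheory Set Filter
open scoped _root_.Topology Real FourierTransform

namespace LongRangePhi4

namespace FRD

open Literature.Probability.LatticeModels

variable {d : ℕ}

/-! ### The continuum symbol and kernel with the constant normalisation `M₀² = 2d` -/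

/-- **The continuum symbol with constant normalisation**: `ŵ₀(t,k) = (t²/(2dc)) f(t√((|k|₂²+s)/(2d)))` —
`ŵ_c` of `RigorousRGSmallParameterFRDSelfSimilarity.lean` with the `s`-dependent `M² = 2d+s` of the
lattice construction replaced by its value `M₀² = 2d` at `s = 0`, so that the scaling function below
does not depend on `s` through the normalisation (Slade's constant `c` in `(c/t)^{d-2}w̄(cx/t;st²)`).
[cite: Slade2017, §10.3 (display (10.38): a fixed constant c)] [cite: Bauerschmidt2013, Example 1.3 (display (eq:const-coeff-w-w*-approximation): φ_t(cx,cy;m²) with a fixed c > 0)] -/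
def wHatCont0 (d : ℕ) (s t : ℝ) (k : Fin d → ℝ) : ℝ :=
  t ^ 2 / (cProfile * (2 * d)) * (profile (t * Real.sqrt ((sqNorm k + s) / (2 * d)))).re

/-- **The continuum kernel with constant normalisation** `w₀(t,x;s) = (2π)^{-d}∫_{ℝ^d}ŵ₀(t,k)cos(k·x)dk`.
[cite: Slade2017, §10.3 (display (10.38))] -/
def wKerCont0 (d : ℕ) (s t : ℝ) (x : Site d) : ℝ :=
  ((2 * π) ^ d : ℝ)⁻¹ * ∫ k, wHatCont0 d s t k * Real.cos (phase k x)

/-- `k ↦ ŵ₀(t,k)` is continuous. [folklore] -/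
theorem continuous_wHatCont0 (s t : ℝ) : Continuous (wHatCont0 d s t) := by
  have hsq : Continuous (sqNorm : (Fin d → ℝ) → ℝ) := by
    unfold sqNorm
    fun_prop
  unfold wHatCont0
  refine continuous_const.mul (Complex.continuous_re.comp (profile.continuous.comp
    (continuous_const.mul ((hsq.add continuous_const).div_const _).sqrt)))

/-- The scaled decay weight against the `2d`-normalised symbol: `1 + ‖(2t/(πM))k‖² ≤ 1 + t²|k|₂²/M²
≤ …` and also `1 + ‖(2t/(πM))k‖² ≤ 1 + t²X/(2d+s)` for any `X ≥ |k|₂²`. [folklore] -/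
theorem one_add_norm_smul_sq_le_of_le {k : Fin d → ℝ} {X t M2 : ℝ} (hX : sqNorm k ≤ X) (ht : 0 ≤ t)
    (hM : 0 < M2) : 1 + ‖(2 * t / (π * Real.sqrt M2)) • k‖ ^ 2 ≤ 1 + t ^ 2 * X / M2 := by
  refine (one_add_norm_smul_sq_le_sqNorm k ht hM).trans ?_
  have : t ^ 2 * sqNorm k / M2 ≤ t ^ 2 * X / M2 :=
    div_le_div_of_nonneg_right (mul_le_mul_of_nonneg_left hX (sq_nonneg t)) hM.le
  linarith
set_option maxHeartbeats 400000 in -- buildfix (bf3-g27): 160k/180k FAIL, 200k PASS at accept time; line-neutral budget line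
/-- **The normalisation comparison, pointwise**: for `d ≥ 1`, `s ∈ (0,1]`, `t ≥ 0` and all `k`,
`|ŵ_c(t,k) - ŵ₀(t,k)| ≤ C (1+t²s/(2d+s))^{-p} (1+‖(2t/(πM))k‖²)^{-q}` with `C = C(d,p,q)`: the two
terms `(t²/(cM²) - t²/(2dc))f(u₁)` (`= t²s/(2dcM²)·f(u₁)`, and `t²s(1+t²s/M²)^{-1} ≤ M²`) and
`(t²/(2dc))(f(u₁) - f(u₂))`, `u₁ = t√(X/M²) ≤ u₂ = t√(X/2d)`, `X = |k|₂²+s`, by the mean value inequality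
with `u₂ - u₁ ≤ u₁s/(4d)` and the rapid decay of `f'` (`u₁(1+u₁)^{-1} ≤ 1`).
[cite: Bauerschmidt2013, §3.2.2 (proof of (eq:const-coeff-w-w*-approximation): "Similarly, we may proceed for the other differences")] -/
theorem abs_wHatCont_sub_wHatCont0_le (hd : 1 ≤ d) (p q : ℕ) :
    ∃ C : ℝ, 0 < C ∧ ∀ s : ℝ, 0 < s → s ≤ 1 → ∀ t : ℝ, 0 ≤ t → ∀ k : Fin d → ℝ,
      |wHatCont d s t k - wHatCont0 d s t k| ≤
        C * ((1 + t ^ 2 * s / (2 * d + s)) ^ p)⁻¹ *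
          ((1 + ‖(2 * t / (π * Real.sqrt (2 * d + s))) • k‖ ^ 2) ^ q)⁻¹ := by
  have hd' : (1 : ℝ) ≤ d := by exact_mod_cast hd
  have hc := cProfile_pos
  obtain ⟨CA, hCA, hfA⟩ := abs_profile_sqrt_le profile (p + 1 + q)
  obtain ⟨CB, hCB, hF'⟩ := norm_deriv_le_div_one_add_pow profile (2 * (p + 1 + q) + 1)
  -- constants: `N₀ = 2d ≥ 2`, `N ≤ 2d+1`
  refine ⟨CA / (cProfile * (2 * d)) + CB * (2 * d + 1) / (2 * cProfile * (2 * d) ^ 2), by positivity,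
    fun s hs hs1 t ht k => ?_⟩
  have hN0 : (0 : ℝ) < 2 * d := by positivity
  have hN : 0 < 2 * (d : ℝ) + s := by positivity
  have hNle : 2 * (d : ℝ) + s ≤ 2 * d + 1 := by linarith
  set X : ℝ := sqNorm k + s with hXdef
  have hX0 : 0 < X := add_pos_of_nonneg_of_pos (sqNorm_nonneg k) hs
  have hXk : sqNorm k ≤ X := by rw [hXdef]; linarith
  set u₁ : ℝ := t * Real.sqrt (X / (2 * d + s)) with hu₁
  set u₂ : ℝ := t * Real.sqrt (X / (2 * d)) with hu₂
  have hu₁0 : 0 ≤ u₁ := by positivity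
  have hζle : X / (2 * d + s) ≤ X / (2 * d) := div_le_div_of_nonneg_left hX0.le hN0 (by linarith)
  have hu₁₂ : u₁ ≤ u₂ := mul_le_mul_of_nonneg_left (Real.sqrt_le_sqrt hζle) ht
  -- `u₂ - u₁ ≤ u₁ s/(4d)`: `u₂ = u₁√(N/N₀)` and `√(1+x) ≤ 1 + x/2`
  have hratio : u₂ = u₁ * Real.sqrt ((2 * d + s) / (2 * d)) := by
    rw [hu₂, hu₁, mul_assoc, ← Real.sqrt_mul (by positivity : (0 : ℝ) ≤ X / (2 * d + s))]
    congr 2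
    field_simp
  have hq : Real.sqrt ((2 * d + s) / (2 * d)) ≤ 1 + s / (2 * (2 * d)) := by
    rw [Real.sqrt_le_iff]
    constructor
    · positivity
    · have e : (2 * d + s) / (2 * d) = 1 + 2 * (s / (2 * (2 * (d : ℝ)))) := by
        field_simp
      rw [e]
      nlinarith [sq_nonneg (s / (2 * (2 * (d : ℝ))))]
  have hdu : u₂ - u₁ ≤ u₁ * (s / (2 * (2 * d))) := by
    rw [hratio]
    have : 0 ≤ u₁ * (1 + s / (2 * (2 * d)) - Real.sqrt ((2 * d + s) / (2 * d))) :=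
      mul_nonneg hu₁0 (by linarith)
    nlinarith
  -- decay factors
  have hP0 : 0 < 1 + t ^ 2 * s / (2 * d + s) := by positivity
  have hsq1 : (1 + t ^ 2 * (X / (2 * d + s))) ^ (p + 1 + q) ≤ (1 + u₁) ^ (2 * (p + 1 + q)) := by
    rw [pow_mul]
    apply pow_le_pow_left₀ (by positivity)
    have : u₁ ^ 2 = t ^ 2 * (X / (2 * d + s)) := by
      rw [hu₁, mul_pow, Real.sq_sqrt (by positivity)]
    nlinarith
  have hsplit : ((1 + t ^ 2 * (X / (2 * d + s))) ^ (p + 1 + q))⁻¹ ≤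
      ((1 + t ^ 2 * s / (2 * d + s)) ^ (p + 1))⁻¹ *
        ((1 + ‖(2 * t / (π * Real.sqrt (2 * d + s))) • k‖ ^ 2) ^ q)⁻¹ := by
    have hA : 1 + t ^ 2 * s / (2 * d + s) ≤ 1 + t ^ 2 * (X / (2 * d + s)) := by
      rw [mul_div_assoc]
      have hsX : s ≤ X := by rw [hXdef]; linarith [sqNorm_nonneg k]
      have : s / (2 * d + s) ≤ X / (2 * d + s) := div_le_div_of_nonneg_right hsX hN.le
      nlinarith [sq_nonneg t]
    have hB : 1 + ‖(2 * t / (π * Real.sqrt (2 * d + s))) • k‖ ^ 2 ≤ 1 + t ^ 2 * (X / (2 * d + s)) := by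
      rw [← mul_div_assoc]
      exact one_add_norm_smul_sq_le_of_le hXk ht hN
    rw [← mul_inv, pow_add]
    apply inv_anti₀ (by positivity)
    exact mul_le_mul (pow_le_pow_left₀ hP0.le hA _) (pow_le_pow_left₀ (by positivity) hB _)
      (by positivity) (by positivity)
  -- `t²s (1+t²s/N)^{-(p+1)} ≤ N (1+t²s/N)^{-p}`
  have hts : t ^ 2 * s * ((1 + t ^ 2 * s / (2 * d + s)) ^ (p + 1))⁻¹ ≤
      (2 * d + s) * ((1 + t ^ 2 * s / (2 * d + s)) ^ p)⁻¹ := by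
    have key : t ^ 2 * s * (1 + t ^ 2 * s / (2 * d + s))⁻¹ ≤ 2 * d + s := by
      rw [← div_eq_mul_inv, div_le_iff₀ hP0]
      have e : (2 * d + s) * (1 + t ^ 2 * s / (2 * d + s)) = 2 * d + s + t ^ 2 * s := by field_simp
      rw [e]
      linarith
    calc t ^ 2 * s * ((1 + t ^ 2 * s / (2 * d + s)) ^ (p + 1))⁻¹
        = t ^ 2 * s * (1 + t ^ 2 * s / (2 * d + s))⁻¹ * ((1 + t ^ 2 * s / (2 * d + s)) ^ p)⁻¹ := by
          rw [pow_succ (1 + t ^ 2 * s / (2 * d + s)) p, mul_inv]; ring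
      _ ≤ (2 * d + s) * ((1 + t ^ 2 * s / (2 * d + s)) ^ p)⁻¹ :=
          mul_le_mul_of_nonneg_right key (by positivity)
  -- Term A
  have hTA : |(t ^ 2 / (cProfile * (2 * d + s)) - t ^ 2 / (cProfile * (2 * d))) *
      (profile u₁).re| ≤ CA / (cProfile * (2 * d)) * ((1 + t ^ 2 * s / (2 * d + s)) ^ p)⁻¹ *
        ((1 + ‖(2 * t / (π * Real.sqrt (2 * d + s))) • k‖ ^ 2) ^ q)⁻¹ := by
    have e : t ^ 2 / (cProfile * (2 * d + s)) - t ^ 2 / (cProfile * (2 * d)) =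
        -(t ^ 2 * s / (cProfile * (2 * d) * (2 * d + s))) := by
      field_simp
      ring
    rw [abs_mul, e, abs_neg, abs_of_nonneg (by positivity)]
    have h1 := hfA t ht (X / (2 * d + s)) (by positivity)
    rw [← hu₁] at h1
    calc t ^ 2 * s / (cProfile * (2 * d) * (2 * d + s)) * |(profile u₁).re|
        ≤ t ^ 2 * s / (cProfile * (2 * d) * (2 * d + s)) *
            (CA * (((1 + t ^ 2 * s / (2 * d + s)) ^ (p + 1))⁻¹ *
              ((1 + ‖(2 * t / (π * Real.sqrt (2 * d + s))) • k‖ ^ 2) ^ q)⁻¹)) := by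
          refine mul_le_mul_of_nonneg_left (h1.trans ?_) (by positivity)
          rw [div_eq_mul_inv]
          exact mul_le_mul_of_nonneg_left hsplit hCA.le
      _ = CA / (cProfile * (2 * d) * (2 * d + s)) *
            (t ^ 2 * s * ((1 + t ^ 2 * s / (2 * d + s)) ^ (p + 1))⁻¹) *
              ((1 + ‖(2 * t / (π * Real.sqrt (2 * d + s))) • k‖ ^ 2) ^ q)⁻¹ := by ring
      _ ≤ CA / (cProfile * (2 * d) * (2 * d + s)) *
            ((2 * d + s) * ((1 + t ^ 2 * s / (2 * d + s)) ^ p)⁻¹) *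
              ((1 + ‖(2 * t / (π * Real.sqrt (2 * d + s))) • k‖ ^ 2) ^ q)⁻¹ :=
          mul_le_mul_of_nonneg_right (mul_le_mul_of_nonneg_left hts (by positivity)) (by positivity)
      _ = _ := by
          rw [div_mul_eq_mul_div, div_mul_eq_mul_div, div_mul_eq_mul_div, div_mul_eq_mul_div,
            div_eq_div_iff (by positivity) (by positivity)]
          ring
  -- Term B: mean value on `[u₁, u₂]`
  have hseg : ∀ u ∈ Icc u₁ u₂, ‖deriv profile u‖ ≤ CB * ((1 + u₁) ^ (2 * (p + 1 + q) + 1))⁻¹ := by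
    intro u hu
    have hu0 : 0 ≤ u := le_trans hu₁0 hu.1
    refine (hF' u).trans ?_
    rw [abs_of_nonneg hu0, div_eq_mul_inv]
    apply mul_le_mul_of_nonneg_left _ hCB.le
    apply inv_anti₀ (by positivity)
    exact pow_le_pow_left₀ (by positivity) (by linarith [hu.1]) _
  have hmvt := Convex.norm_image_sub_le_of_norm_deriv_le (s := Icc u₁ u₂)
    (fun u _ => profile.differentiableAt) hseg (convex_Icc _ _)
    (left_mem_Icc.2 hu₁₂) (right_mem_Icc.2 hu₁₂)
  have hTB : |t ^ 2 / (cProfile * (2 * d)) * ((profile u₁).re - (profile u₂).re)| ≤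
      CB * (2 * d + 1) / (2 * cProfile * (2 * d) ^ 2) * ((1 + t ^ 2 * s / (2 * d + s)) ^ p)⁻¹ *
        ((1 + ‖(2 * t / (π * Real.sqrt (2 * d + s))) • k‖ ^ 2) ^ q)⁻¹ := by
    rw [abs_mul, abs_of_nonneg (by positivity : (0 : ℝ) ≤ t ^ 2 / (cProfile * (2 * d))),
      ← Complex.sub_re]
    have h1 : |(profile u₁ - profile u₂).re| ≤ CB * ((1 + u₁) ^ (2 * (p + 1 + q) + 1))⁻¹ * (u₁ * (s / (2 * (2 * d)))) := by
      refine (Complex.abs_re_le_norm _).trans ?_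
      rw [← norm_neg, neg_sub]
      refine hmvt.trans (mul_le_mul_of_nonneg_left ?_ (by positivity))
      rw [Real.norm_eq_abs, abs_of_nonneg (by linarith)]
      exact hdu
    -- `u₁ (1+u₁)^{-(K+1)} ≤ (1+u₁)^{-K}` and the decay split
    have h2 : ((1 + u₁) ^ (2 * (p + 1 + q) + 1))⁻¹ * u₁ ≤ ((1 + u₁) ^ (2 * (p + 1 + q)))⁻¹ := by
      rw [pow_succ (1 + u₁) (2 * (p + 1 + q)), mul_inv, mul_assoc]
      refine mul_le_of_le_one_right (by positivity) ?_
      rw [inv_mul_le_iff₀ (by positivity)]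
      linarith
    have h3 : ((1 + u₁) ^ (2 * (p + 1 + q)))⁻¹ ≤ ((1 + t ^ 2 * s / (2 * d + s)) ^ (p + 1))⁻¹ *
        ((1 + ‖(2 * t / (π * Real.sqrt (2 * d + s))) • k‖ ^ 2) ^ q)⁻¹ :=
      (inv_anti₀ (by positivity) hsq1).trans hsplit
    have h4 : t ^ 2 * ((1 + t ^ 2 * s / (2 * d + s)) ^ (p + 1))⁻¹ * s ≤
        (2 * d + s) * ((1 + t ^ 2 * s / (2 * d + s)) ^ p)⁻¹ := by
      have := hts; nlinarith [this]
    calc t ^ 2 / (cProfile * (2 * d)) * |(profile u₁ - profile u₂).re|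
        ≤ t ^ 2 / (cProfile * (2 * d)) * (CB * ((1 + u₁) ^ (2 * (p + 1 + q) + 1))⁻¹ * (u₁ * (s / (2 * (2 * d))))) :=
          mul_le_mul_of_nonneg_left h1 (by positivity)
      _ = CB / (cProfile * (2 * d) * (2 * (2 * d))) * t ^ 2 *
            ((((1 + u₁) ^ (2 * (p + 1 + q) + 1))⁻¹ * u₁) * s) := by ring
      _ ≤ CB / (cProfile * (2 * d) * (2 * (2 * d))) * t ^ 2 *
            ((((1 + t ^ 2 * s / (2 * d + s)) ^ (p + 1))⁻¹ *
              ((1 + ‖(2 * t / (π * Real.sqrt (2 * d + s))) • k‖ ^ 2) ^ q)⁻¹) * s) :=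
          mul_le_mul_of_nonneg_left (mul_le_mul_of_nonneg_right (h2.trans h3) hs.le) (by positivity)
      _ = CB / (cProfile * (2 * d) * (2 * (2 * d))) *
            (t ^ 2 * ((1 + t ^ 2 * s / (2 * d + s)) ^ (p + 1))⁻¹ * s) *
              ((1 + ‖(2 * t / (π * Real.sqrt (2 * d + s))) • k‖ ^ 2) ^ q)⁻¹ := by ring
      _ ≤ CB / (cProfile * (2 * d) * (2 * (2 * d))) *
            ((2 * d + s) * ((1 + t ^ 2 * s / (2 * d + s)) ^ p)⁻¹) *
              ((1 + ‖(2 * t / (π * Real.sqrt (2 * d + s))) • k‖ ^ 2) ^ q)⁻¹ := by gcongr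
      _ ≤ CB / (cProfile * (2 * d) * (2 * (2 * d))) *
            ((2 * d + 1) * ((1 + t ^ 2 * s / (2 * d + s)) ^ p)⁻¹) *
              ((1 + ‖(2 * t / (π * Real.sqrt (2 * d + s))) • k‖ ^ 2) ^ q)⁻¹ := by gcongr
      _ = _ := by ring
  -- combine
  have e : wHatCont d s t k - wHatCont0 d s t k =
      (t ^ 2 / (cProfile * (2 * d + s)) - t ^ 2 / (cProfile * (2 * d))) * (profile u₁).re +
        t ^ 2 / (cProfile * (2 * d)) * ((profile u₁).re - (profile u₂).re) := by
    simp only [wHatCont, wHatCont0, hu₁, hu₂, hXdef]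
    ring
  rw [e]
  refine (abs_add_le _ _).trans ?_
  have := add_le_add hTA hTB
  refine this.trans (le_of_eq ?_)
  ring

/-- **The normalisation comparison for the kernels**: for `d ≥ 1` and every `p` there is `C(d,p)` with
`|w_c(t,x;s) - w₀(t,x;s)| ≤ C t^{-d} (1+t²s/(2d+s))^{-p}` for all `s ∈ (0,1]`, `t > 0`, `x` — one order
`t⁻¹` better than (10.38). [cite: Slade2017, §10.3 (display (10.38), uniformity in s ≤ 1)] -/
theorem abs_wKerCont_sub_wKerCont0_le (hd : 1 ≤ d) (p : ℕ) :
    ∃ C : ℝ, 0 < C ∧ ∀ s : ℝ, 0 < s → s ≤ 1 → ∀ t : ℝ, 0 < t → ∀ x : Site d,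
      |wKerCont d s t x - wKerCont0 d s t x| ≤ C * (t ^ d)⁻¹ * ((1 + t ^ 2 * s / (2 * d + s)) ^ p)⁻¹ := by
  have hd' : (1 : ℝ) ≤ d := by exact_mod_cast hd
  have hc := cProfile_pos
  have hπ := Real.pi_pos
  set g : (Fin d → ℝ) → ℝ := fun u => ((1 + ‖u‖ ^ 2) ^ d)⁻¹ with hg
  have hgi : Integrable g := integrable_inv_one_add_norm_sq_pow (by omega)
  have hg0 : ∀ u, 0 ≤ g u := fun u => by positivity
  set I : ℝ := ∫ u, g u with hI
  have hI0 : 0 ≤ I := integral_nonneg hg0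
  obtain ⟨C₀, hC₀, hcmp⟩ := abs_wHatCont_sub_wHatCont0_le hd p d
  obtain ⟨C₄, hC₄, hcmp4⟩ := abs_wHatCont_le (d := d) p d 0
  set D : ℝ := (2 * (d : ℝ) + 1) ^ d with hD
  refine ⟨((2 * π) ^ d : ℝ)⁻¹ * (C₀ * (π / 2) ^ d * D * I) + 1, by positivity,
    fun s hs hs1 t ht x => ?_⟩
  obtain ⟨M2, hM2def⟩ : ∃ z : ℝ, z = 2 * d + s := ⟨_, rfl⟩
  have hM : 0 < M2 := by rw [hM2def]; positivity
  obtain ⟨M, hMdef⟩ : ∃ z : ℝ, z = Real.sqrt M2 := ⟨_, rfl⟩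
  have hM0 : 0 < M := by rw [hMdef]; exact Real.sqrt_pos.2 hM
  have hMle : M ≤ 2 * d + 1 := by
    rw [hMdef, Real.sqrt_le_iff]
    constructor
    · positivity
    · rw [hM2def]; nlinarith
  have hMd : M ^ d ≤ D := pow_le_pow_left₀ hM0.le hMle d
  obtain ⟨a, ha⟩ : ∃ z : ℝ, z = 2 * t / (π * M) := ⟨_, rfl⟩
  have ha0 : 0 < a := by rw [ha]; positivity
  obtain ⟨P, hPdef⟩ : ∃ z : ℝ, z = ((1 + t ^ 2 * s / M2) ^ p)⁻¹ := ⟨_, rfl⟩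
  have hP0 : 0 < P := by rw [hPdef]; positivity
  have had : (a ^ d)⁻¹ = (π / 2) ^ d * (M ^ d / t ^ d) := by
    rw [ha, div_pow, mul_pow, inv_div, div_pow, mul_pow]
    field_simp
  have hc0 : ∀ k : Fin d → ℝ, |wHatCont d s t k - wHatCont0 d s t k| ≤ C₀ * P * g (a • k) := by
    intro k
    have h1 := hcmp s hs hs1 t ht.le k
    rw [← hM2def, ← hMdef, ← ha, ← hPdef] at h1
    exact h1
  have hc4 : ∀ k : Fin d → ℝ, |wHatCont d s t k| ≤
      t ^ 2 / (cProfile * M2) * C₄ * P * ((1 + t ^ 2 * sqNorm k / M2) ^ 0)⁻¹ * g (a • k) := by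
    intro k
    have h1 := hcmp4 s hs t ht.le k
    rw [← hM2def, ← hMdef, ← ha, ← hPdef] at h1
    exact h1
  have hcontc := continuous_wHatCont (d := d) s t
  have hcont0 := continuous_wHatCont0 (d := d) s t
  -- integrability of both Fourier integrands on `ℝ^d`
  have hcci : Integrable fun k : Fin d → ℝ => wHatCont d s t k * Real.cos (phase k x) := by
    refine Integrable.mono' (((hgi.comp_smul ha0.ne').const_mul (t ^ 2 / (cProfile * M2) * C₄ * P)))
      ((hcontc.mul (Real.continuous_cos.comp (continuous_phase x))).aestronglyMeasurable)
      (Eventually.of_forall fun k => ?_)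
    rw [Real.norm_eq_abs, abs_mul]
    refine (mul_le_of_le_one_right (abs_nonneg _) (Real.abs_cos_le_one _)).trans ?_
    have := hc4 k
    rw [pow_zero, inv_one, mul_one] at this
    exact this
  have hdi : Integrable fun k : Fin d → ℝ => (wHatCont d s t k - wHatCont0 d s t k) * Real.cos (phase k x) := by
    refine Integrable.mono' (((hgi.comp_smul ha0.ne').const_mul (C₀ * P)))
      (((hcontc.sub hcont0).mul (Real.continuous_cos.comp (continuous_phase x))).aestronglyMeasurable)
      (Eventually.of_forall fun k => ?_)
    rw [Real.norm_eq_abs, abs_mul]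
    exact (mul_le_of_le_one_right (abs_nonneg _) (Real.abs_cos_le_one _)).trans (hc0 k)
  have hc0i : Integrable fun k : Fin d → ℝ => wHatCont0 d s t k * Real.cos (phase k x) := by
    have := hcci.sub hdi
    refine this.congr (Eventually.of_forall fun k => ?_)
    simp only [Pi.sub_apply]
    ring
  -- the difference of the kernels
  have hsplit : wKerCont d s t x - wKerCont0 d s t x = ((2 * π) ^ d : ℝ)⁻¹ *
      ∫ k, (wHatCont d s t k - wHatCont0 d s t k) * Real.cos (phase k x) := by
    unfold wKerCont wKerCont0
    rw [← mul_sub, ← integral_sub hcci hc0i]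
    congr 1
    exact integral_congr_ae (Eventually.of_forall fun k => by ring)
  have hT := setIntegral_le_of_le_mul_comp_smul (d := d) MeasurableSet.univ
    (F := fun k => ‖wHatCont d s t k - wHatCont0 d s t k‖) (g := g)
    (by simpa using (hcontc.sub hcont0).aestronglyMeasurable.norm) (fun k _ => norm_nonneg _)
    hgi hg0 (by positivity : (0 : ℝ) ≤ C₀ * P) ha0 (fun k _ => by
      rw [Real.norm_eq_abs]; exact hc0 k)
  rw [Measure.restrict_univ] at hT
  have hB : |∫ k, (wHatCont d s t k - wHatCont0 d s t k) * Real.cos (phase k x)| ≤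
      C₀ * P * ((a ^ d)⁻¹ * I) := by
    have hle : ∀ k, ‖(wHatCont d s t k - wHatCont0 d s t k) * Real.cos (phase k x)‖ ≤
        ‖wHatCont d s t k - wHatCont0 d s t k‖ := by
      intro k
      rw [norm_mul]
      refine mul_le_of_le_one_right (norm_nonneg _) ?_
      rw [Real.norm_eq_abs]; exact Real.abs_cos_le_one _
    have h1 := norm_integral_le_of_norm_le (integrableOn_univ.mp hT.1) (Eventually.of_forall hle)
    rw [Real.norm_eq_abs] at h1
    exact h1.trans hT.2
  have hπd : (0 : ℝ) < ((2 * π) ^ d : ℝ)⁻¹ := by positivity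
  rw [← hM2def, ← hPdef, hsplit, abs_mul, abs_of_pos hπd]
  have hE : C₀ * P * ((a ^ d)⁻¹ * I) ≤ C₀ * (π / 2) ^ d * D * I * ((t ^ d)⁻¹ * P) := by
    have e : C₀ * P * ((a ^ d)⁻¹ * I) = C₀ * (π / 2) ^ d * M ^ d * I * ((t ^ d)⁻¹ * P) := by
      rw [had]; ring
    rw [e]
    gcongr
  calc ((2 * π) ^ d : ℝ)⁻¹ * |∫ k, (wHatCont d s t k - wHatCont0 d s t k) * Real.cos (phase k x)|
      ≤ ((2 * π) ^ d : ℝ)⁻¹ * (C₀ * (π / 2) ^ d * D * I * ((t ^ d)⁻¹ * P)) :=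
        mul_le_mul_of_nonneg_left (hB.trans hE) hπd.le
    _ = ((2 * π) ^ d : ℝ)⁻¹ * (C₀ * (π / 2) ^ d * D * I) * (t ^ d)⁻¹ * P := by ring
    _ ≤ (((2 * π) ^ d : ℝ)⁻¹ * (C₀ * (π / 2) ^ d * D * I) + 1) * (t ^ d)⁻¹ * P := by
        have : 0 ≤ (t ^ d)⁻¹ * P := by positivity
        nlinarith

/-- **Scale invariance of `w₀`**: with `M₀ = √(2d)`,
`w₀(t,x;s) = (M₀/t)^d (t²/(2dc)) w̄(M₀x/t; st²/(2d))`, i.e. `w₀ = c⁻¹(M₀/t)^{d-2}w̄(M₀x/t; st²/M₀²)` —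
Slade's `(c/t)^{d-2}w̄(cx/t; st²)` with the constant `c = M₀` (and `st² ↦ st²/M₀²`, normalisation
`cProfile⁻¹`). [cite: Slade2017, §10.3 (display (10.38))] [cite: Bauerschmidt2013, §3.2.2 ((eq:const-coeff-w-hom): "this is scale invariance")] -/
theorem wKerCont0_eq_scaling (hd : 1 ≤ d) (s : ℝ) {t : ℝ} (ht : 0 < t) (hs : 0 ≤ s) (x : Site d) :
    wKerCont0 d s t x = (Real.sqrt (2 * d) / t) ^ d * (t ^ 2 / (cProfile * (2 * d))) *
      wbar d (s * t ^ 2 / (2 * d)) (fun i => Real.sqrt (2 * d) * (x i : ℝ) / t) := by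
  have hd' : (0 : ℝ) < d := by exact_mod_cast hd
  have hM2 : 0 < 2 * (d : ℝ) := by positivity
  set M : ℝ := Real.sqrt (2 * d) with hM
  have hM0 : 0 < M := Real.sqrt_pos.2 hM2
  have hMsq : M ^ 2 = 2 * d := Real.sq_sqrt hM2.le
  set b : ℝ := M / t with hb
  have hb0 : 0 < b := by positivity
  set G : (Fin d → ℝ) → ℝ := fun k => wHatCont0 d s t k * Real.cos (phase k x) with hG
  have hcomp := Measure.integral_comp_smul volume G b
  rw [Module.finrank_fin_fun, abs_of_nonneg (inv_nonneg.2 (pow_nonneg hb0.le _)), smul_eq_mul] at hcomp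
  have hint : ∫ k, G k = b ^ d * ∫ u, G (b • u) := by
    rw [hcomp, ← mul_assoc, mul_inv_cancel₀ (pow_ne_zero d hb0.ne'), one_mul]
  have hpt : ∀ u : Fin d → ℝ, G (b • u) = t ^ 2 / (cProfile * (2 * d)) *
      ((profile (Real.sqrt (sqNorm u + s * t ^ 2 / (2 * d)))).re *
        Real.cos (∑ i, u i * (M * (x i : ℝ) / t))) := by
    intro u
    have hX0 : 0 ≤ (b ^ 2 * sqNorm u + s) / (2 * d) :=
      div_nonneg (add_nonneg (mul_nonneg (sq_nonneg b) (sqNorm_nonneg u)) hs) hM2.le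
    have e1 : t * Real.sqrt ((b ^ 2 * sqNorm u + s) / (2 * d)) =
        Real.sqrt (sqNorm u + s * t ^ 2 / (2 * d)) := by
      calc t * Real.sqrt ((b ^ 2 * sqNorm u + s) / (2 * d))
          = Real.sqrt (t ^ 2) * Real.sqrt ((b ^ 2 * sqNorm u + s) / (2 * d)) := by
            rw [Real.sqrt_sq ht.le]
        _ = Real.sqrt (t ^ 2 * ((b ^ 2 * sqNorm u + s) / (2 * d))) := (Real.sqrt_mul' _ hX0).symm
        _ = Real.sqrt (sqNorm u + s * t ^ 2 / (2 * d)) := by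
            congr 1
            rw [hb, div_pow, hMsq]
            field_simp
    have e2 : (∑ i, (b • u) i * (x i : ℝ)) = ∑ i, u i * (M * (x i : ℝ) / t) :=
      Finset.sum_congr rfl fun i _ => by rw [Pi.smul_apply, smul_eq_mul, hb]; ring
    simp only [hG, wHatCont0, phase]
    rw [sqNorm_smul, e1, e2]
    ring
  unfold wKerCont0 wbar
  rw [show (fun k => wHatCont0 d s t k * Real.cos (phase k x)) = G from rfl, hint,
    integral_congr_ae (Eventually.of_forall hpt), integral_const_mul, hb]
  ring

/-- **(10.38) with an `s`-independent scaling function, PROVED**: for `d ≥ 1` and every `p` there is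
`C(d,p)` with `|w(t,x;s) - w₀(t,x;s)| ≤ C (t²/t^d) t⁻¹ (1+t²s/(2d+s))^{-p}` for all `s ∈ (0,1]`,
`t ≥ 1`, `x ∈ ℤ^d`, where `w₀(t,x;s) = c⁻¹(M₀/t)^{d-2} w̄(M₀x/t; st²/M₀²)`, `M₀ = √(2d)`
(`wKerCont0_eq_scaling`) — Slade's "`w(t,x;s) = (c/t)^{d-2}w̄(cx/t;st²) + O(t^{-(d-1)}(1+st²)^{-p})` …
uniform in bounded `s`, and in particular for `s ≤ 1`".
[cite: Slade2017, §10.3 (display (10.38))] [cite: Bauerschmidt2013, Example 1.3 (display (eq:const-coeff-w-w*-approximation))] -/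
theorem abs_wKer_sub_wKerCont0_le (hd : 1 ≤ d) (p : ℕ) :
    ∃ C : ℝ, 0 < C ∧ ∀ s : ℝ, 0 < s → s ≤ 1 → ∀ t : ℝ, 1 ≤ t → ∀ x : Site d,
      |wKer d s t x - wKerCont0 d s t x| ≤
        C * (t ^ 2 / t ^ d) * t⁻¹ * ((1 + t ^ 2 * s / (2 * d + s)) ^ p)⁻¹ := by
  obtain ⟨C₁, hC₁, h₁⟩ := abs_wKer_sub_wKerCont_le hd p
  obtain ⟨C₂, hC₂, h₂⟩ := abs_wKerCont_sub_wKerCont0_le hd p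
  refine ⟨C₁ + C₂, by positivity, fun s hs hs1 t ht x => ?_⟩
  have ht0 : 0 < t := by linarith
  have hA := h₁ s hs hs1 t ht x
  have hB := h₂ s hs hs1 t ht0 x
  have hP0 : 0 < ((1 + t ^ 2 * s / (2 * d + s)) ^ p)⁻¹ := by
    have : (0 : ℝ) ≤ d := Nat.cast_nonneg d
    positivity
  -- `t^{-d} ≤ (t²/t^d) t⁻¹` for `t ≥ 1`
  have hcmp : (t ^ d)⁻¹ ≤ t ^ 2 / t ^ d * t⁻¹ := by
    have e : t ^ 2 / t ^ d * t⁻¹ = t * (t ^ d)⁻¹ := by field_simp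
    rw [e]
    exact le_mul_of_one_le_left (by positivity) ht
  calc |wKer d s t x - wKerCont0 d s t x|
      ≤ |wKer d s t x - wKerCont d s t x| + |wKerCont d s t x - wKerCont0 d s t x| := abs_sub_le _ _ _
    _ ≤ C₁ * (t ^ 2 / t ^ d) * t⁻¹ * ((1 + t ^ 2 * s / (2 * d + s)) ^ p)⁻¹ +
          C₂ * (t ^ d)⁻¹ * ((1 + t ^ 2 * s / (2 * d + s)) ^ p)⁻¹ := add_le_add hA hB
    _ ≤ C₁ * (t ^ 2 / t ^ d) * t⁻¹ * ((1 + t ^ 2 * s / (2 * d + s)) ^ p)⁻¹ +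
          C₂ * (t ^ 2 / t ^ d * t⁻¹) * ((1 + t ^ 2 * s / (2 * d + s)) ^ p)⁻¹ := by
        gcongr
    _ = (C₁ + C₂) * (t ^ 2 / t ^ d) * t⁻¹ * ((1 + t ^ 2 * s / (2 * d + s)) ^ p)⁻¹ := by ring

/-! ### Decay of the scaling function: Slade (10.39) -/

/-- **Slade (10.39) — decay of `w̄` in its second argument, PROVED**: for `d ≥ 1` and every `p`
there is `C(d,p)` with `|w̄(y;σ)| ≤ C(1+σ)^{-p}` for all `σ ≥ 0`, `y ∈ ℝ^d` ("For any `p ≥ 0`, the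
function `w̄` obeys (by [Baue13a]) `w̄(cx/t;st²) ≤ O(1+st²)^{-p}`"): the rapid decay
`|f(√(|u|₂²+σ))| ≤ C(1+|u|₂²+σ)^{-(p+q)} ≤ C(1+σ)^{-p}(1+‖u‖²)^{-q}` integrated over `ℝ^d`.
[cite: Slade2017, §10.3 (display (10.39))] [cite: Bauerschmidt2013, §3.2.2 (display (eq:const-coeff-w-est) with l = 0)] -/
theorem abs_wbar_le (hd : 1 ≤ d) (p : ℕ) :
    ∃ C : ℝ, 0 < C ∧ ∀ σ : ℝ, 0 ≤ σ → ∀ y : Fin d → ℝ, |wbar d σ y| ≤ C * ((1 + σ) ^ p)⁻¹ := by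
  have hπ := Real.pi_pos
  set g : (Fin d → ℝ) → ℝ := fun u => ((1 + ‖u‖ ^ 2) ^ d)⁻¹ with hg
  have hgi : Integrable g := integrable_inv_one_add_norm_sq_pow (by omega)
  have hg0 : ∀ u, 0 ≤ g u := fun u => by positivity
  set I : ℝ := ∫ u, g u with hI
  have hI0 : 0 ≤ I := integral_nonneg hg0
  obtain ⟨C, hC, hf⟩ := abs_profile_sqrt_le profile (p + d)
  refine ⟨((2 * π) ^ d : ℝ)⁻¹ * (C * I) + 1, by positivity, fun σ hσ y => ?_⟩
  have hpt : ∀ u : Fin d → ℝ, |(profile (Real.sqrt (sqNorm u + σ))).re * Real.cos (∑ i, u i * y i)| ≤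
      C * ((1 + σ) ^ p)⁻¹ * g u := by
    intro u
    rw [abs_mul]
    refine (mul_le_of_le_one_right (abs_nonneg _) (Real.abs_cos_le_one _)).trans ?_
    have h1 := hf 1 zero_le_one (sqNorm u + σ) (add_nonneg (sqNorm_nonneg u) hσ)
    rw [one_mul, one_pow, one_mul] at h1
    refine h1.trans ?_
    simp only [hg]
    rw [mul_assoc, ← mul_inv]
    refine mul_le_mul_of_nonneg_left (inv_anti₀ (by positivity) ?_) hC.le
    rw [pow_add]
    have hA : 1 + σ ≤ 1 + (sqNorm u + σ) := by linarith [sqNorm_nonneg u]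
    have hB : 1 + ‖u‖ ^ 2 ≤ 1 + (sqNorm u + σ) := by linarith [norm_sq_le_sqNorm u]
    exact mul_le_mul (pow_le_pow_left₀ (by positivity) hA p) (pow_le_pow_left₀ (by positivity) hB d)
      (by positivity) (pow_nonneg (by linarith [sqNorm_nonneg u]) _)
  have hFi : Integrable fun u : Fin d → ℝ =>
      (profile (Real.sqrt (sqNorm u + σ))).re * Real.cos (∑ i, u i * y i) := by
    have hsq : Continuous (sqNorm : (Fin d → ℝ) → ℝ) := by
      unfold sqNorm
      fun_prop
    have hcont : Continuous fun u : Fin d → ℝ =>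
        (profile (Real.sqrt (sqNorm u + σ))).re * Real.cos (∑ i, u i * y i) :=
      (Complex.continuous_re.comp (profile.continuous.comp (hsq.add continuous_const).sqrt)).mul
        (Real.continuous_cos.comp (by fun_prop))
    refine Integrable.mono' (hgi.const_mul (C * ((1 + σ) ^ p)⁻¹)) hcont.aestronglyMeasurable
      (Eventually.of_forall fun u => by rw [Real.norm_eq_abs]; exact hpt u)
  have hB : |∫ u : Fin d → ℝ, (profile (Real.sqrt (sqNorm u + σ))).re * Real.cos (∑ i, u i * y i)| ≤
      C * ((1 + σ) ^ p)⁻¹ * I := by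
    have h1 := norm_integral_le_of_norm_le (hgi.const_mul (C * ((1 + σ) ^ p)⁻¹))
      (Eventually.of_forall fun u => by rw [Real.norm_eq_abs]; exact hpt u)
    rw [Real.norm_eq_abs, integral_const_mul] at h1
    exact h1
  have hπd : (0 : ℝ) < ((2 * π) ^ d : ℝ)⁻¹ := by positivity
  unfold wbar
  rw [abs_mul, abs_of_pos hπd]
  calc ((2 * π) ^ d : ℝ)⁻¹ * |∫ u : Fin d → ℝ, (profile (Real.sqrt (sqNorm u + σ))).re * Real.cos (∑ i, u i * y i)|
      ≤ ((2 * π) ^ d : ℝ)⁻¹ * (C * ((1 + σ) ^ p)⁻¹ * I) := mul_le_mul_of_nonneg_left hB hπd.le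
    _ = ((2 * π) ^ d : ℝ)⁻¹ * (C * I) * ((1 + σ) ^ p)⁻¹ := by ring
    _ ≤ (((2 * π) ^ d : ℝ)⁻¹ * (C * I) + 1) * ((1 + σ) ^ p)⁻¹ := by
        have : 0 ≤ ((1 + σ) ^ p)⁻¹ := by positivity
        nlinarith

end FRD

end LongRangePhi4

end Literature.Barriers.CriticalPhenomena
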